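import Summits.QuantumFields.YangMills.Theorems.FluctuationComparisonRegPrIntLS1aEMLBoundarySliceNull
import Summits.QuantumFields.YangMills.Theorems.FluctuationComparisonRegPrIntLS1aGuardSphereNull
import Literature.MathematicalPhysics.QuantumFieldTheory.Balaban1983to89.FieldMeasureExpChartChangeOfVariablesInverse
import Literature.MathematicalPhysics.QuantumFieldTheory.Balaban1983to89.BlockAveragingCentralBlind
import HarnessLib

/-!
# `FluctuationComparisonRegPrIntLS1aChartSideNullTraces` — (F4-c) OF px17 g21's ROAD TO S1aᴴ (c) AT THE ANCHOR HEIGHTS: THE TWO CHART-SIDE, NON-PRIVATE-MARGINAL NULL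
# TRACES — in the bond-wise exponential chart of `SU(2)^{bonds}` centred at any `U₀`, restricted to the NON-PRIVATE bonds `{b // ∀ c′, b ≠ β(c′)}` (private coordinates
# filled arbitrarily — the sets are blind to them), the pull-backs of (F4-b)'s EML-branch boundary slice (✓p824672) and of the identity-branch guard sphere (✓p822129's letter)
# are `⊗η`-NULL on the chart window, for EVERY coarse value `v`

Cell `ym3-torus` (HUMAN RULING D-0037: rung R3 = continuum SU(2) Yang–Mills on T³ — a RUNG: NOT d = 4, NOT infinite volume, NOT a mass gap, NOT Clay), WIDTH COPY «width 20»
of ym3-torus-p1, seat `ym3-torus-px20` gen 22; `--kind proof --supports stmt-QuantumFields-20520 --as helper` (count-neutral).  THEOREMS ONLY (0 `def`, 0 `sorry`, 0 `instance`,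
0 `notation`, default heartbeats, `autoImplicit false`).  STATEMENTS = px17 g21's elaborating `sorry`-SPEC `F4c-WANTED.SPEC.px17g21.lean` (ee7018b35b6eaefb, 13:58:10Z) VERBATIM
(binders `[MeasurableSpace 𝔰𝔲(2).lie] [BorelSpace …] (η) [η.IsAddHaarMeasure]`, `Function.extend Subtype.val k 0` kept); consumer = px17's (F5b) `…S1aCellMapLocalFace.localFace_cellMap`
(hypotheses `hNullE` ∕ `hNullI`).

ROUTE (px17's three steps, all in the tree).  §1 ★★`pi_setOf_chart_eq_zero_of_fieldMeasure_eq_zero_of_blind` — for ANY predicate `Q` on gauge fields BLIND to the private coordinates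
(`Q U ↔ Q U′` whenever `U`, `U′` agree on the non-private bonds) with `dU {U | Q U} = 0`: (1) CYLINDER — split `dU = (⊗_{NP} Haar) ⊗ (⊗_{priv} Haar)` along Mathlib
`MeasurableEquiv.piEquivPiSubtypeProd` (`measurePreserving_piEquivPiSubtypeProd`; lit ✓`fieldMeasure_eq_pi`): `{Q} ≃ A ×ˢ univ` with `A = {x : NP → SU(2) | Q (fill x)}`, so
`(⊗_{NP} Haar) A · 1 = 0` (`Measure.prod_prod`, no measurability needed); (2) CHART PULL-BACK on `B := NP` — lit ✓`IsChartRep.map_piChart_translate_restrict_eq_smul_withDensity`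
(`isChartRep_specialUnitaryGroup`, `lie_adStable_specialUnitaryGroup`, `det_jac_ne_zero_of_subset_pi_ball`): `((⊗η)|_T).map Θ_{U₀} = c • (⊗Haar|_{img}).withDensity f ≪ ⊗_{NP} Haar`,
`T` = the window `B(0,s_C)^{NP}`, so the window part of `Θ⁻¹(toMeasurable A)` is `⊗η`-null; (3) the SPEC's set lies inside it (`Function.extend Subtype.val k 0 ↑b = k b` by injectivity;
blindness moves between the two private fillings).  §2 BLINDNESS of the two letters: `fibreFamily U c W i` reads `U` only through `openHol U c i`, blind to every private bond
(lit ✓`BlockAveragingCentralBlind.openHol_extend_centralBond`) — `fibreFamily_congr_of_forall_nonPrivate`.  §3 the two WANTED theorems: ★★★`pi_setOf_chart_mem_boundarySlice_eq_zero`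
(⟸ ✓p824672 `fieldMeasure_setOf_exists_boundary_preimage_eq_zero`) and ★★★`pi_setOf_chart_mem_guardSphere_eq_zero` (⟸ ✓p822129 `fieldMeasure_setOf_dist1_fibreFamily_eq_eq_zero`, finite union).

HONEST FRAMING.  [folklore] measure theory (product splitting + a change of variables already in the tree); nothing of Bałaban's renormalisation-group analysis is asserted or
proved; S1aᴴ (c) is NOT closed by this file ((F5b)(F6)(F7) px17's); the five registered stubs of `Lines/semiclassical_s2beta.lean` (3732b7df, untouched), crux 20520 ∕ 19936 ∕
19200 and `YM3TorusSU2` are NOT proved; registry untouched; rung R3 = SU(2) YM₃ on T³ at fixed lattice data — NOT d = 4, NOT infinite volume, NOT a mass gap, NOT Clay; the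
Yang–Mills mass gap is NOT proved by any of this.
References: [Balaban1987RG1] T. Bałaban, CMP **109** (1987) 249–301, (0.4) p. 253; [Balaban1985UV3] CMP **102** (1985) 255–275, (18) p. 260; [Balaban1985Averaging] CMP **98**
(1985) 17–51, (10) p. 19.
-/

set_option autoImplicit false

noncomputable section

namespace Summit.QuantumFields.YangMills.Theorems.FluctuationComparisonRegPrIntLS1aChartSideNullTraces

open MeasureTheory Set Function Filter Topology
open scoped ENNReal Matrix.Norms.L2Operator
open Literature.MathematicalPhysics.QuantumFieldTheory.Balaban1983to89
open Literature.MathematicalPhysics.QuantumFieldTheory.Balaban1983to89.HaarExponentialChart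
open Literature.MathematicalPhysics.QuantumFieldTheory.Balaban1983to89.HaarExponentialChart.IsChartRep
open T4Continuum BlockAveraging BlockAveragingHaarAC BlockAveragingEMLHaarAC
open ExpMeanLog (eml deltaSU deltaSU_pos)
open Summit.QuantumFields.YangMills.Theorems.FluctuationComparisonRegPrIntLS1aEMLBoundarySliceNull (fieldMeasure_setOf_exists_boundary_preimage_eq_zero)
open Summit.QuantumFields.YangMills.Theorems.FluctuationComparisonRegPrIntLS1aGuardSphereNull (fieldMeasure_setOf_dist1_fibreFamily_eq_eq_zero)

variable {P : Params} {j : ℕ}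

/-! ## §1 Blindness of the two letters: `fibreFamily` reads `U` only through the open holonomies, which see no private bond -/

/-- Two configurations that agree on every NON-PRIVATE bond are related by resampling the private coordinates: `U′ = extend β (U′ ∘ β) U`. [folklore] -/
theorem eq_extend_centralBond_of_forall_nonPrivate (hj : j + 1 ≤ P.m + P.K) {G : Type*} (U U' : GaugeField P j G)
    (h : ∀ b : PBond P j, (∀ c' : PBond P (j + 1), b ≠ centralBond c') → U b = U' b) :
    U' = Function.extend (centralBond (P := P) (j := j)) (fun c' => U' (centralBond c')) U := by
  classical
  funext b
  by_cases hb : ∃ c', centralBond (P := P) (j := j) c' = b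
  · obtain ⟨c', rfl⟩ := hb
    rw [(centralBond_injective hj).extend_apply]
  · rw [Function.extend_apply' _ _ _ hb]
    exact (h b fun c' hc => hb ⟨c', hc.symm⟩).symm

/-- ★ **THE W-FAMILY IS BLIND TO THE PRIVATE COORDINATES**: if `U`, `U′` agree on every non-private bond then `fibreFamily U c W i = fibreFamily U′ c W i` (central `i`: both `1`;
off-central: lit ✓`BlockAveragingCentralBlind.openHol_extend_centralBond`). [cite: Balaban1987RG1, (0.4) p.253] -/
theorem fibreFamily_congr_of_forall_nonPrivate (hj : j + 1 ≤ P.m + P.K) {G : Type*} [GaugeGroup G] (U U' : GaugeField P j G)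
    (h : ∀ b : PBond P j, (∀ c' : PBond P (j + 1), b ≠ centralBond c') → U b = U' b) (c : PBond P (j + 1)) (W : G) (i : Idx P) :
    fibreFamily U c W i = fibreFamily U' c W i := by
  classical
  by_cases hi : IsCentral c i
  · rw [fibreFamily_of_isCentral U c W i hi, fibreFamily_of_isCentral U' c W i hi]
  · rw [fibreFamily_of_not_isCentral U c W i hi, fibreFamily_of_not_isCentral U' c W i hi,
      eq_extend_centralBond_of_forall_nonPrivate hj U U' h, BlockAveragingCentralBlind.openHol_extend_centralBond hj U c i hi]

variable [MeasurableSpace (specialUnitaryLogChart (Fin 2)).lie] [BorelSpace (specialUnitaryLogChart (Fin 2)).lie]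
  (η : Measure (specialUnitaryLogChart (Fin 2)).lie) [η.IsAddHaarMeasure]

/-! ## §2 The generic transfer: a `dU`-null set blind to the private coordinates is `⊗η`-null on the chart window over the non-private bonds -/

/-- ★★ **CYLINDER + CHART PULL-BACK.**  Let `Q` be a property of gauge fields BLIND to the private coordinates (`Q U ↔ Q U′` whenever `U b = U′ b` for every non-private bond
`b`, i.e. every `b ≠ β(c′)` for all `c′`) with `dU {U | Q U} = 0`.  Then for every `U₀` the set of non-private chart coordinates `k` in the window `B(0, s_C)^{NP}` with
`Q (b ↦ expChart (extend val k 0 b) · U₀ b)` is `⊗_{NP} η`-null. [cite: Balaban1985UV3, (18) p.260] -/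
theorem pi_setOf_chart_eq_zero_of_fieldMeasure_eq_zero_of_blind (U₀ : GaugeField P j (Matrix.specialUnitaryGroup (Fin 2) ℂ))
    (Q : GaugeField P j (Matrix.specialUnitaryGroup (Fin 2) ℂ) → Prop)
    (hQ : ∀ U U' : GaugeField P j (Matrix.specialUnitaryGroup (Fin 2) ℂ),
      (∀ b : PBond P j, (∀ c' : PBond P (j + 1), b ≠ centralBond c') → U b = U' b) → (Q U ↔ Q U'))
    (hnull : fieldMeasure P j (Matrix.specialUnitaryGroup (Fin 2) ℂ) {U | Q U} = 0) :
    Measure.pi (fun _ : {b : PBond P j // ∀ c' : PBond P (j + 1), b ≠ centralBond c'} => η)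
      {k | (∀ b, k b ∈ Metric.ball (0 : (specialUnitaryLogChart (Fin 2)).lie) (chartRadius (specialUnitaryLogChart (Fin 2)))) ∧
        Q (fun b : PBond P j => (isChartRep_specialUnitaryGroup (n := Fin 2)).expChart (Function.extend Subtype.val k 0 b) * U₀ b)} = 0 := by
  classical
  -- instances
  haveI : IsProbabilityMeasure (HaarData.haar : Measure (Matrix.specialUnitaryGroup (Fin 2) ℂ)) := HaarData.isProb
  haveI := FieldMeasureExpChartChangeOfVariables.isHaarMeasure_haar_specialUnitaryGroup (N := 2)
  haveI : (HaarData.haar : Measure (Matrix.specialUnitaryGroup (Fin 2) ℂ)).IsMulRightInvariant :=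
    FieldMeasureExpChartChangeOfVariables.isMulRightInvariant_haar
  -- names
  set p : PBond P j → Prop := fun b => ∀ c' : PBond P (j + 1), b ≠ centralBond c' with hp
  set μH : Measure (Matrix.specialUnitaryGroup (Fin 2) ℂ) := HaarData.haar with hμH
  -- the private filling of a non-private configuration by `1`
  set fill : ({b : PBond P j // p b} → Matrix.specialUnitaryGroup (Fin 2) ℂ) → GaugeField P j (Matrix.specialUnitaryGroup (Fin 2) ℂ) :=
    fun x b => if h : p b then x ⟨b, h⟩ else 1 with hfill
  set A : Set ({b : PBond P j // p b} → Matrix.specialUnitaryGroup (Fin 2) ℂ) := {x | Q (fill x)} with hA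
  -- (1) CYLINDER: `(⊗_{NP} Haar) A = 0`
  have hA0 : Measure.pi (fun _ : {b : PBond P j // p b} => μH) A = 0 := by
    have hmp := measurePreserving_piEquivPiSubtypeProd (fun _ : PBond P j => μH) p
    set e := MeasurableEquiv.piEquivPiSubtypeProd (fun _ : PBond P j => Matrix.specialUnitaryGroup (Fin 2) ℂ) p with he
    -- `{Q} = e ⁻¹' (A ×ˢ univ)`
    have hpre : {U : GaugeField P j (Matrix.specialUnitaryGroup (Fin 2) ℂ) | Q U} = e ⁻¹' (A ×ˢ (Set.univ : Set ({b : PBond P j // ¬ p b} → _))) := by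
      ext U
      show Q U ↔ e U ∈ A ×ˢ (Set.univ : Set ({b : PBond P j // ¬ p b} → Matrix.specialUnitaryGroup (Fin 2) ℂ))
      rw [Set.mem_prod, and_iff_left (Set.mem_univ _)]
      show Q U ↔ Q (fill (e U).1)
      refine hQ U (fill (e U).1) fun b hb => ?_
      show U b = (if h : p b then (e U).1 ⟨b, h⟩ else 1)
      rw [dif_pos hb]; rfl
    have h1 : (Measure.pi fun _ : PBond P j => μH) {U | Q U} = 0 := by
      rw [← FieldMeasureExpChartChangeOfVariables.fieldMeasure_eq_pi]; exact hnull
    have h2 : ((Measure.pi fun _ : {b : PBond P j // p b} => μH).prod (Measure.pi fun _ : {b : PBond P j // ¬ p b} => μH))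
        (A ×ˢ Set.univ) = 0 := by
      rw [← hmp.map_eq, MeasurableEquiv.map_apply, ← hpre]; exact h1
    rw [Measure.prod_prod, measure_univ, mul_one] at h2
    exact h2
  -- a measurable null hull of `A`
  set A' := toMeasurable (Measure.pi fun _ : {b : PBond P j // p b} => μH) A with hA'
  have hA'm : MeasurableSet A' := measurableSet_toMeasurable _ _
  have hA'0 : Measure.pi (fun _ : {b : PBond P j // p b} => μH) A' = 0 := by rw [hA', measure_toMeasurable]; exact hA0
  -- (2) CHART PULL-BACK on the non-private bonds
  set s : ℝ := chartRadius (specialUnitaryLogChart (Fin 2)) with hs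
  set T : Set ({b : PBond P j // p b} → (specialUnitaryLogChart (Fin 2)).lie) :=
    Set.pi Set.univ fun _ => Metric.ball (0 : (specialUnitaryLogChart (Fin 2)).lie) s with hT
  have hTm : MeasurableSet T := MeasurableSet.univ_pi fun _ => Metric.isOpen_ball.measurableSet
  set Θ : ({b : PBond P j // p b} → (specialUnitaryLogChart (Fin 2)).lie) → ({b : PBond P j // p b} → Matrix.specialUnitaryGroup (Fin 2) ℂ) :=
    fun k b => (isChartRep_specialUnitaryGroup (n := Fin 2)).expChart (k b) * U₀ b.1 with hΘ
  have hΘm : Measurable Θ :=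
    measurable_pi_lambda _ fun b =>
      ((isChartRep_specialUnitaryGroup (n := Fin 2)).measurable_expChart.comp (measurable_pi_apply b)).mul_const _
  have hmap := (isChartRep_specialUnitaryGroup (n := Fin 2)).map_piChart_translate_restrict_eq_smul_withDensity
    (lie_adStable_specialUnitaryGroup (n := Fin 2)) η μH {b : PBond P j // p b} (chartRadius_pos (C := specialUnitaryLogChart (Fin 2))) le_rfl hTm
    (subset_refl _) (FieldMeasureExpChartChangeOfVariables.det_jac_ne_zero_of_subset_pi_ball le_rfl (subset_refl _)) (fun b => U₀ b.1)
  have hmap' : ((Measure.pi fun _ : {b : PBond P j // p b} => η).restrict T).map Θ =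
      ((μH ((isChartRep_specialUnitaryGroup (n := Fin 2)).window s) /
          (isChartRep_specialUnitaryGroup (n := Fin 2)).chartMeasure (lie_adStable_specialUnitaryGroup (n := Fin 2)) η s
            ((isChartRep_specialUnitaryGroup (n := Fin 2)).window s)) ^ Fintype.card {b : PBond P j // p b})⁻¹ •
        ((Measure.pi fun _ : {b : PBond P j // p b} => μH).restrict
            ((fun (U : {b : PBond P j // p b} → Matrix.specialUnitaryGroup (Fin 2) ℂ) (b : {b : PBond P j // p b}) => U b * U₀ b.1) ''
              ((fun (A : {b : PBond P j // p b} → (specialUnitaryLogChart (Fin 2)).lie) (b : {b : PBond P j // p b}) =>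
                (isChartRep_specialUnitaryGroup (n := Fin 2)).expChart (A b)) '' T))).withDensity
          (fun U => (∏ b, jacDensity (lie_adStable_specialUnitaryGroup (n := Fin 2))
            ((isChartRep_specialUnitaryGroup (n := Fin 2)).logChart (U b * (U₀ b.1)⁻¹)))⁻¹) := hmap
  have hres : ((Measure.pi fun _ : {b : PBond P j // p b} => μH).restrict
      ((fun (U : {b : PBond P j // p b} → Matrix.specialUnitaryGroup (Fin 2) ℂ) (b : {b : PBond P j // p b}) => U b * U₀ b.1) ''
        ((fun (A : {b : PBond P j // p b} → (specialUnitaryLogChart (Fin 2)).lie) (b : {b : PBond P j // p b}) =>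
          (isChartRep_specialUnitaryGroup (n := Fin 2)).expChart (A b)) '' T))) A' = 0 :=
    le_antisymm ((Measure.le_iff'.1 Measure.restrict_le_self A').trans hA'0.le) bot_le
  have hpull : ((Measure.pi fun _ : {b : PBond P j // p b} => η).restrict T) (Θ ⁻¹' A') = 0 := by
    rw [← Measure.map_apply hΘm hA'm, hmap', Measure.smul_apply, smul_eq_mul]
    exact mul_eq_zero_of_right _ (withDensity_absolutelyContinuous _ _ hres)
  -- (3) the SPEC's set lies in `T ∩ Θ ⁻¹' A'`
  have hsub : {k : {b : PBond P j // p b} → (specialUnitaryLogChart (Fin 2)).lie |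
      (∀ b, k b ∈ Metric.ball (0 : (specialUnitaryLogChart (Fin 2)).lie) (chartRadius (specialUnitaryLogChart (Fin 2)))) ∧
        Q (fun b : PBond P j => (isChartRep_specialUnitaryGroup (n := Fin 2)).expChart (Function.extend Subtype.val k 0 b) * U₀ b)} ⊆ Θ ⁻¹' A' ∩ T := by
    rintro k ⟨hk, hQk⟩
    refine ⟨?_, fun b _ => hk b⟩
    show Θ k ∈ A'
    refine subset_toMeasurable _ _ ?_
    show Q (fill (Θ k))
    refine (hQ _ _ fun b hb => ?_).1 hQk
    show (isChartRep_specialUnitaryGroup (n := Fin 2)).expChart (Function.extend Subtype.val k 0 b) * U₀ b = (if h : p b then Θ k ⟨b, h⟩ else 1)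
    rw [dif_pos hb]
    show (isChartRep_specialUnitaryGroup (n := Fin 2)).expChart (Function.extend Subtype.val k 0 b) * U₀ b =
      (isChartRep_specialUnitaryGroup (n := Fin 2)).expChart (k ⟨b, hb⟩) * U₀ b
    have hext : Function.extend Subtype.val k 0 b = k ⟨b, hb⟩ := Subtype.val_injective.extend_apply k 0 ⟨b, hb⟩
    rw [hext]
  refine measure_mono_null hsub ?_
  rw [← Measure.restrict_apply' hTm]; exact hpull

/-! ## §3 (F4-c): the two WANTED chart-side null traces -/

/-- ★★★ **(F4-c-EML)**: in the bond-wise exponential chart centred at `U₀`, restricted to the NON-PRIVATE bonds `{b // ∀ c′, b ≠ β(c′)}` (private coordinates extended by `0` —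
immaterial, the slice set is blind to every private bond), the chart pull-back of (F4-b)'s boundary slice (✓p824672) is `⊗η`-null on the window of radius `s_C`, for every
`r ≠ 0`, every extension `E` of the printed `exp[mean log]` off the `1∕2`-guard and EVERY coarse value `v`. [cite: Balaban1987RG1, (0.4) p.253] [cite: Balaban1985UV3, (18) p.260] -/
theorem pi_setOf_chart_mem_boundarySlice_eq_zero (hj : j + 1 ≤ P.m + P.K) (U₀ : GaugeField P j (Matrix.specialUnitaryGroup (Fin 2) ℂ))
    (c : PBond P (j + 1)) {r : ℝ} (hr : r ≠ 0)
    (E : (Idx P → Matrix.specialUnitaryGroup (Fin 2) ℂ) → Matrix.specialUnitaryGroup (Fin 2) ℂ)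
    (hE : ∀ W : Idx P → Matrix.specialUnitaryGroup (Fin 2) ℂ, (∀ i, ‖((W i : Matrix.specialUnitaryGroup (Fin 2) ℂ) : Matrix (Fin 2) (Fin 2) ℂ) - 1‖ < 1 / 2) →
      ((E W : Matrix.specialUnitaryGroup (Fin 2) ℂ) : Matrix (Fin 2) (Fin 2) ℂ) = eml (fun i => ((W i : Matrix.specialUnitaryGroup (Fin 2) ℂ) : Matrix (Fin 2) (Fin 2) ℂ)))
    (v : Matrix.specialUnitaryGroup (Fin 2) ℂ) :
    Measure.pi (fun _ : {b : PBond P j // ∀ c' : PBond P (j + 1), b ≠ centralBond c'} => η)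
      {k | (∀ b, k b ∈ Metric.ball (0 : (specialUnitaryLogChart (Fin 2)).lie) (chartRadius (specialUnitaryLogChart (Fin 2)))) ∧
        ∃ W : Matrix.specialUnitaryGroup (Fin 2) ℂ,
          (∀ i, dist1 (fibreFamily (fun b : PBond P j => (isChartRep_specialUnitaryGroup (n := Fin 2)).expChart (Function.extend Subtype.val k 0 b) * U₀ b) c W i) < 1 / 2) ∧
          (∃ i, dist1 (fibreFamily (fun b : PBond P j => (isChartRep_specialUnitaryGroup (n := Fin 2)).expChart (Function.extend Subtype.val k 0 b) * U₀ b) c W i) = r) ∧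
          E (fibreFamily (fun b : PBond P j => (isChartRep_specialUnitaryGroup (n := Fin 2)).expChart (Function.extend Subtype.val k 0 b) * U₀ b) c W) * W = v} = 0 := by
  refine pi_setOf_chart_eq_zero_of_fieldMeasure_eq_zero_of_blind η U₀
    (fun U => ∃ W : Matrix.specialUnitaryGroup (Fin 2) ℂ, (∀ i, dist1 (fibreFamily U c W i) < 1 / 2) ∧ (∃ i, dist1 (fibreFamily U c W i) = r) ∧
      E (fibreFamily U c W) * W = v) (fun U U' hUU' => ?_) (fieldMeasure_setOf_exists_boundary_preimage_eq_zero hj c hr E hE v)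
  have hfam : ∀ W, fibreFamily U c W = fibreFamily U' c W := fun W => funext fun i => fibreFamily_congr_of_forall_nonPrivate hj U U' hUU' c W i
  simp only [hfam]

/-- ★★★ **(F4-c-id)**: the same for the identity branch — the chart pull-back of the guard sphere `{∃ i, dist1 (fibreFamily U c v i) = r}` (✓p822129's letter
`fieldMeasure_setOf_dist1_fibreFamily_eq_eq_zero`, finite union over the indices) is `⊗η`-null on the window, for every `r ≠ 0` and every `v`. [cite: Balaban1987RG1, (0.4) p.253]
[cite: Balaban1985UV3, (18) p.260] -/
theorem pi_setOf_chart_mem_guardSphere_eq_zero (hj : j + 1 ≤ P.m + P.K) (U₀ : GaugeField P j (Matrix.specialUnitaryGroup (Fin 2) ℂ))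
    (c : PBond P (j + 1)) {r : ℝ} (hr : r ≠ 0) (v : Matrix.specialUnitaryGroup (Fin 2) ℂ) :
    Measure.pi (fun _ : {b : PBond P j // ∀ c' : PBond P (j + 1), b ≠ centralBond c'} => η)
      {k | (∀ b, k b ∈ Metric.ball (0 : (specialUnitaryLogChart (Fin 2)).lie) (chartRadius (specialUnitaryLogChart (Fin 2)))) ∧
        ∃ i, dist1 (fibreFamily (fun b : PBond P j => (isChartRep_specialUnitaryGroup (n := Fin 2)).expChart (Function.extend Subtype.val k 0 b) * U₀ b) c v i) = r} = 0 := by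
  have hnull : fieldMeasure P j (Matrix.specialUnitaryGroup (Fin 2) ℂ) {U | ∃ i, dist1 (fibreFamily U c v i) = r} = 0 := by
    have he : {U : GaugeField P j (Matrix.specialUnitaryGroup (Fin 2) ℂ) | ∃ i, dist1 (fibreFamily U c v i) = r} = ⋃ i, {U | dist1 (fibreFamily U c v i) = r} := by
      ext U; simp only [Set.mem_setOf_eq, Set.mem_iUnion]
    rw [he]
    exact (measure_iUnion_null_iff).2 fun i => fieldMeasure_setOf_dist1_fibreFamily_eq_eq_zero hj c i v hr
  refine pi_setOf_chart_eq_zero_of_fieldMeasure_eq_zero_of_blind η U₀ (fun U => ∃ i, dist1 (fibreFamily U c v i) = r) (fun U U' hUU' => ?_) hnull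
  have hfam : fibreFamily U c v = fibreFamily U' c v := funext fun i => fibreFamily_congr_of_forall_nonPrivate hj U U' hUU' c v i
  simp only [hfam]

end Summit.QuantumFields.YangMills.Theorems.FluctuationComparisonRegPrIntLS1aChartSideNullTraces

end
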